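import Literature.AlgebraicGeometry.AbelianSchemes.AbelianSchemeOverRingAction
import HarnessLib

/-!
# (GS-1a) Transport of a ring action `ι : 𝒪 → End_S(A)` along an isomorphism of abelian schemes over one base

Topic `AlgebraicGeometry/AbelianSchemes`, namespace `Literature.AlgebraicGeometry.AbelianSchemes.AbelianSchemeOver` (grouping sub-namespace
`RingAction`).  THEOREMS ONLY (no definition, no named fact, no instance, no notation, no `sorry`).  Cell `hodgecm-mathlib` (D-0151), FLOOR 0,
P6 «MOD» (crux hLiu418 = stmt-HodgeConjecture-24832, `--supports`), organ **(GS-1a)** of B-p18 (g38)՚s census «ONE-COMMON-STAGE → EVERY GOOD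
PRIME» (`CENSUS-GS1-OneCommonStage.v1`, §2 «ring action ✗ — no `RingAction` transport constructor found»; LEAD heir F0P6-plan (g3) 01:09:11Z):
the `stub_SPREAD` road transports the PEL tuple `(𝒜, ι, D, λ, φ)` along isomorphisms `e : 𝒜 ≅ 𝒜′` of abelian schemes over one base
(level ★ `LevelStructure.exists_comp_of_iso`, polarisation ★ `Polarization.exists_lam_eq_lamTransport`, Rosati ★ `RingAction.rosati_lamTransport`);
this file supplies the missing RING-ACTION leg.  HC_CM is proved only modulo the printed citations (2 remaining named inputs hLiu418 24832,
h413 24833) until rung 0 closes; this file is generic and changes no count.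

THE MATHEMATICS ([Kottwitz1992] §5: «`i : 𝒪_B → End(A)`»; transport of structure).  For `ρ : RingAction 𝒪 A` and an isomorphism
`e : A.X ≅ A′.X` OVER `S` whose `hom` is a homomorphism of `S`-group schemes (then so is `e.inv`, Mathlib instance), the conjugates
`ι′(a) := e⁻¹ ≫ ι(a) ≫ e` are homomorphisms, `ι′(1) = 𝟙`, `ι′(ab) = ι′(b) ≫ ι′(a)`, and — because pre-composition with ANY map and
post-composition with a HOMOMORPHISM are group homomorphisms of the Hom-groups `Hom_S(·, A)` (Mathlib `MonObj.comp_mul` ∕ `MonObj.mul_comp`,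
`MonObj.comp_one` ∕ `MonObj.one_comp`) — `ι′(0) = 1` and `ι′(a + b) = ι′(a) · ι′(b)`.  So `ι′` is a ring action on `A′`.

* §1 **`RingAction.exists_transport_of_iso`** — `∃ ρ′ : RingAction 𝒪 A′, ∀ a, ρ′.i a = e.inv ≫ ρ.i a ≫ e.hom` (B-p18՚s token shape).
* §2 `RingAction.exists_transport_of_iso_symm` — the same along `e : A′.X ≅ A.X` (`ρ′.i a = e.hom ≫ ρ.i a ≫ e.inv`);
  `RingAction.exists_transport_of_iso_comp` — point-level reading `f ≫ ρ′.i a = ((f ≫ e.inv) ≫ ρ.i a) ≫ e.hom` and equivariance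
  `ρ′.i a ≫ e.inv = e.inv ≫ ρ.i a`, `e.hom ≫ ρ′.i a = ρ.i a ≫ e.hom`.

## References
* [Kottwitz1992] R. E. Kottwitz, *Points on some Shimura varieties over finite fields*, J. Amer. Math. Soc. 5 (1992), §5 (p. 390).
* [MumfordFogartyKirwan1994] D. Mumford, J. Fogarty, F. Kirwan, *Geometric Invariant Theory*, 3rd ed. (1994), Ch. 6 §1 (group schemes over a base,
  homomorphisms; p. 115).
-/

set_option autoImplicit false

noncomputable section

universe u

open CategoryTheory CategoryTheory.Limits AlgebraicGeometry MonoidalCategory CartesianMonoidalCategory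
open scoped MonObj

namespace Literature.AlgebraicGeometry.AbelianSchemes

namespace AbelianSchemeOver

variable {S : Scheme.{u}} {A A' : AbelianSchemeOver S} {O : Type*} [CommRing O]

namespace RingAction

/-! ### §1 The transport -/

/-- **(GS-1a) TRANSPORT OF A RING ACTION ALONG AN ISOMORPHISM OVER THE BASE.**  For `ρ : RingAction 𝒪 A` and an isomorphism `e : A.X ≅ A′.X` of
`S`-schemes whose `hom` is a homomorphism of `S`-group schemes, there is a ring action `ρ′` of `𝒪` on `A′` with `ρ′.i a = e.inv ≫ ρ.i a ≫ e.hom`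
for every `a` (conjugation; the additive clauses because pre-composition and post-composition with a homomorphism respect the group laws of the
Hom-groups). [cite: Kottwitz1992, §5 (p. 390)] [cite: MumfordFogartyKirwan1994, Ch. 6 §1 Definition 6.1 (p. 115)] -/
theorem exists_transport_of_iso (ρ : RingAction O A) (e : A.X ≅ A'.X) [IsMonHom e.hom] :
    ∃ ρ' : RingAction O A', ∀ a, ρ'.i a = e.inv ≫ ρ.i a ≫ e.hom := by
  haveI : IsMonHom e.inv := inferInstance
  haveI := ρ.isMonHom
  refine ⟨{ i := fun a => e.inv ≫ ρ.i a ≫ e.hom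
            isMonHom := fun a => inferInstance
            i_one := ?_
            i_mul := fun a b => ?_
            i_zero := ?_
            i_add := fun a b => ?_ }, fun a => rfl⟩
  · -- `ι′(1) = e⁻¹ ≫ 𝟙 ≫ e = 𝟙`
    rw [ρ.i_one, Category.id_comp, e.inv_hom_id]
  · -- `ι′(ab) = e⁻¹ ≫ ι b ≫ ι a ≫ e = (e⁻¹ ≫ ι b ≫ e) ≫ (e⁻¹ ≫ ι a ≫ e)`
    rw [ρ.i_mul]
    simp only [Category.assoc, e.hom_inv_id_assoc]
  · -- `ι′(0) = e⁻¹ ≫ 1 ≫ e = 1`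
    rw [ρ.i_zero, MonObj.one_comp, MonObj.comp_one]
  · -- `ι′(a + b) = e⁻¹ ≫ (ι a * ι b) ≫ e = ι′ a * ι′ b`
    rw [ρ.i_add, MonObj.mul_comp, MonObj.comp_mul]

/-! ### §2 The other orientation; point-level reading and equivariance -/

/-- **Transport along `e : A′.X ≅ A.X`** (the orientation of a base-change identification `A′ ≅ A`): `ρ′.i a = e.hom ≫ ρ.i a ≫ e.inv`.
[cite: Kottwitz1992, §5 (p. 390)] -/
theorem exists_transport_of_iso_symm (ρ : RingAction O A) (e : A'.X ≅ A.X) [IsMonHom e.hom] :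
    ∃ ρ' : RingAction O A', ∀ a, ρ'.i a = e.hom ≫ ρ.i a ≫ e.inv := by
  haveI : IsMonHom e.inv := inferInstance
  haveI : IsMonHom e.symm.hom := (inferInstance : IsMonHom e.inv)
  obtain ⟨ρ', h⟩ := exists_transport_of_iso ρ e.symm
  exact ⟨ρ', fun a => by rw [h a]; rfl⟩

/-- **The transported action read on points, and its equivariance with `e`**: with `ρ′` as in §1, for every `T`-valued point `f` of `A′`,
`f ≫ ρ′.i a = ((f ≫ e.inv) ≫ ρ.i a) ≫ e.hom`; and `e.hom ≫ ρ′.i a = ρ.i a ≫ e.hom`, `ρ′.i a ≫ e.inv = e.inv ≫ ρ.i a` (so `e` is an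
`𝒪`-EQUIVARIANT isomorphism `(A, ρ) ≅ (A′, ρ′)`). [cite: Kottwitz1992, §5 (p. 390)] -/
theorem exists_transport_of_iso_comp (ρ : RingAction O A) (e : A.X ≅ A'.X) [IsMonHom e.hom] :
    ∃ ρ' : RingAction O A', (∀ a, ρ'.i a = e.inv ≫ ρ.i a ≫ e.hom) ∧
      (∀ (a : O) {T : Over S} (f : T ⟶ A'.X), f ≫ ρ'.i a = ((f ≫ e.inv) ≫ ρ.i a) ≫ e.hom) ∧
      (∀ a, e.hom ≫ ρ'.i a = ρ.i a ≫ e.hom) ∧ ∀ a, ρ'.i a ≫ e.inv = e.inv ≫ ρ.i a := by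
  obtain ⟨ρ', h⟩ := exists_transport_of_iso ρ e
  refine ⟨ρ', h, fun a T f => ?_, fun a => ?_, fun a => ?_⟩
  · rw [h a, Category.assoc, Category.assoc]
  · rw [h a, e.hom_inv_id_assoc]
  · rw [h a, Category.assoc, Category.assoc, e.hom_inv_id, Category.comp_id]

end RingAction

end AbelianSchemeOver

end Literature.AlgebraicGeometry.AbelianSchemes

end
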